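import Literature.NumberTheory.Sieve.HeathBrownCubicMertensK
import Literature.NumberTheory.Sieve.HeathBrownCubicLemma51
import Literature.NumberTheory.LFunctions.CubeRootTwoFieldPID
import Literature.NumberTheory.Sieve.HeathBrownCubicLatticeCount
import Literature.NumberTheory.Sieve.HeathBrownCubicETermRearrangement
import Literature.NumberTheory.Sieve.HeathBrownCubicWindow
import Mathlib.NumberTheory.RamificationInertia.Basic
import HarnessLib

/-!
# The splitting types of the primes `p ≥ 5` in `ℚ(∛2)` and the local factors `∏_{P∣p}(1 − N(P)⁻¹)`

Topic `Literature/NumberTheory/Sieve`; a PROVED algebraic layer (no named facts) under the named fact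
`Irving2015_largestPrimeFactor_cubic` (`LargestPrimeFactorCubic.lean`), needed to identify
Heath-Brown's constant `C₂C₃ = (log 2)(log 4/3)/(3π²) ∏_{p≥5} k(p)` (D. R. Heath-Brown, *The largest
prime factor of `X³ + 2`*, Proc. London Math. Soc. (3) 82 (2001) 554–596, p. 12): the factor `k(p)`
is `(1 − p⁻³)⁻¹`, `1 − (p+1)⁻²`, `1 − (3p² − 4p − 1)/((p−1)³(p+1))` "according as `g(p) = 0, 1, 3`",
which presupposes (i) that `g(p) = #{P : N(P) = p} ∈ {0, 1, 3}` for `p ≥ 5` and (ii) the three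
splitting types behind the local Euler factors of `ζ_K`, `K = ℚ(∛2)`:
`p = P` inert (`N(P) = p³`), `p = P₁P₂` (`N = p, p²`), `p = P₁P₂P₃` (`N = p` thrice) — i.e. that no
`p ≥ 5` ramifies (`disc ℤ[∛2] = −108`).  We PROVE, for the tree's `K` and `primesAbove p`
(`HeathBrownCubicNormWindowSieve`):

* `primesAbove_eq_primesOverFinset` — the tree's finite set of primes above `p` is Mathlib's
  `primesOverFinset (p)`; hence **`sum_ramification_inertia_eq_three`**: `∑_{P∣p} e_P f_P = 3`
  (Mathlib's fundamental identity) with `N(P) = p^{f_P}` (`absNorm_eq_pow_inertiaDeg'`);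
* `not_totally_ramified`, `not_partially_ramified` — for `p ≥ 5` the configurations `p = P³` and
  `p = P₁²P₂` with first-degree `P, P₁, P₂` are impossible (if `θ ≡ m (mod P)` then the coordinates
  of `(θ − m)³`, resp. `(θ − m₁)²(θ − m₂)`, in the basis `1, θ, θ²` would all be divisible by `p`,
  forcing `p ∣ 3m` and then `p ∣ 2`);
* **`splitting_type`** — for `p ≥ 5` prime, exactly one of: one prime of norm `p³` (`g = 0`); one
  prime of norm `p` and one of norm `p²` (`g = 1`); three primes of norm `p` (`g = 3`); in
  particular **`cubeRootTwoCount_mem`**: `g(p) ∈ {0, 1, 3}`;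
* **`one_sub_normDensityAt_eq`** — `∏_{P∣p}(1 − N(P)⁻¹) = 1 − p⁻³`, `(1 − p⁻¹)(1 − p⁻²)`,
  `(1 − p⁻¹)³` in the three cases (`p ≥ 5`), and the values `1/2`, `2/3` at `p = 2, 3`
  (`one_sub_normDensityAt_two/three`).

## References

* D. R. Heath-Brown, *The largest prime factor of `X³ + 2`*, Proc. London Math. Soc. (3) 82 (2001)
  554–596, p. 12 (`k(p)` by `g(p) = 0, 1, 3`), Lemma 9 (the local factors). [`HeathBrown2001LargestPrimeFactorCubic`]
* J. Neukirch, *Algebraic Number Theory*, Ch. I §8, Prop. 8.2 (`∑ e_i f_i = n`) and Prop. 8.3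
  (Dedekind–Kummer). [`NeukirchANT1999`]

## Mathlib / tree search

Mathlib: `Ideal.sum_ramification_inertia`, `IsDedekindDomain.mem_primesOverFinset_iff`,
`Ideal.absNorm_eq_pow_inertiaDeg'`, `Ideal.inertiaDeg'_ne_zero`,
`Ideal.IsDedekindDomain.ramificationIdx'_ne_zero_of_liesOver`,
`Ideal.IsDedekindDomain.ramificationIdx'_eq_normalizedFactors_count`, `factors_eq_normalizedFactors`,
`UniqueFactorizationMonoid.prod_normalizedFactors`, `Finset.card_eq_one/two/three`.
Tree: `CubicSieve.primesAbove`, `mem_primesAbove_iff`, `card_primesAbove_le`,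
`card_primesAbove_filter_absNorm_eq`, `normDensityAt`,
`CubicSieve.exists_int_θint_sub_mem_of_prime_absNorm` (`HeathBrownCubicLemma51`), `coordElt`,
`coordElt_injective`, `coordElt_surjective`, `coordElt_smul`, `CubeRootTwoField.finrank_K`,
`Literature.NumberTheory.LFunctions.IdealNormCount.mem_primesOver_of_mem_normalizedFactors`.
-/

noncomputable section

open NumberField Finset IsDedekindDomain UniqueFactorizationMonoid

namespace Literature.NumberTheory.Sieve.HeathBrown2001

open LFunctions.CubeRootTwoField CubicSieve
open CubicPrimes (cubeRootTwoCount)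

/-! ### The primes above `p` and the fundamental identity -/

/-- The ideal `pℤ`. [folklore] -/
abbrev pZ (p : ℕ) : Ideal ℤ := Ideal.span {(p : ℤ)}

/-- `pℤ ≠ 0` for a prime `p`. [folklore] -/
theorem pZ_ne_bot {p : ℕ} (hp : p.Prime) : pZ p ≠ ⊥ := by
  simp [pZ, hp.ne_zero]

/-- `pℤ` is maximal. [folklore] -/
theorem pZ_isMaximal {p : ℕ} (hp : p.Prime) : (pZ p).IsMaximal := by
  haveI := Fact.mk hp
  exact Int.ideal_span_isMaximal_of_prime p

/-- The image of `pℤ` in `𝓞_K` is the principal ideal `(p)`. [folklore] -/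
theorem map_pZ (p : ℕ) : Ideal.map (algebraMap ℤ (𝓞 K)) (pZ p) = Ideal.span {((p : ℤ) : 𝓞 K)} := by
  rw [pZ, Ideal.map_span, Set.image_singleton, eq_intCast]

/-- **The tree's `primesAbove p` is Mathlib's `primesOverFinset (pℤ)`**. [folklore] -/
theorem primesAbove_eq_primesOverFinset {p : ℕ} (hp : p.Prime) :
    primesAbove p = IsDedekindDomain.primesOverFinset (pZ p) (𝓞 K) := by
  classical
  haveI := pZ_isMaximal hp
  ext P
  rw [mem_primesAbove_iff hp, IsDedekindDomain.mem_primesOverFinset_iff (pZ_ne_bot hp)]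
  constructor
  · rintro ⟨hP, hP0, hdvd⟩
    refine ⟨hP, ?_⟩
    obtain ⟨f, -, -, hN⟩ := exists_absNorm_eq_pow_of_mem_primesAbove hp
      ((mem_primesAbove_iff hp).mpr ⟨hP, hP0, hdvd⟩)
    have hmem : P ∈ normalizedFactors P := by
      rw [Ideal.mem_normalizedFactors_iff hP0]; exact ⟨hP, le_rfl⟩
    exact (Literature.NumberTheory.LFunctions.IdealNormCount.mem_primesOver_of_mem_normalizedFactors
      hp hN hmem).2
  · rintro ⟨hP, hover⟩
    haveI := hP
    haveI := hover
    have hN : Ideal.absNorm P = p ^ ((pZ p).inertiaDeg' P) := Ideal.absNorm_eq_pow_inertiaDeg' P hp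
    have hf : (pZ p).inertiaDeg' P ≠ 0 := Ideal.inertiaDeg'_ne_zero _ _
    have hP0 : P ≠ ⊥ := by
      intro h
      rw [h, Ideal.absNorm_bot] at hN
      exact (pow_ne_zero _ hp.ne_zero) hN.symm
    exact ⟨hP, hP0, hN ▸ dvd_pow_self p hf⟩

/-- Membership: a prime above `p` lies over `pℤ` and has `N(P) = p^{f_P}`, `f_P, e_P ≥ 1`. [folklore] -/
theorem liesOver_of_mem_primesAbove {p : ℕ} (hp : p.Prime) {P : Ideal (𝓞 K)} (hP : P ∈ primesAbove p) :
    P.IsPrime ∧ P.LiesOver (pZ p) := by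
  classical
  haveI := pZ_isMaximal hp
  rw [primesAbove_eq_primesOverFinset hp] at hP
  exact (IsDedekindDomain.mem_primesOverFinset_iff (pZ_ne_bot hp) _).mp hP

/-- `N(P) = p^{f_P}` with `f_P ≥ 1` and `e_P ≥ 1` for `P` above `p`. [folklore] -/
theorem absNorm_eq_pow_of_mem {p : ℕ} (hp : p.Prime) {P : Ideal (𝓞 K)} (hP : P ∈ primesAbove p) :
    Ideal.absNorm P = p ^ ((pZ p).inertiaDeg' P) ∧ 1 ≤ (pZ p).inertiaDeg' P ∧
      1 ≤ Ideal.ramificationIdx' (pZ p) P := by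
  obtain ⟨hP', hover⟩ := liesOver_of_mem_primesAbove hp hP
  haveI := hP'
  haveI := hover
  haveI := pZ_isMaximal hp
  refine ⟨Ideal.absNorm_eq_pow_inertiaDeg' P hp, Nat.one_le_iff_ne_zero.mpr (Ideal.inertiaDeg'_ne_zero _ _),
    Nat.one_le_iff_ne_zero.mpr (Ideal.IsDedekindDomain.ramificationIdx'_ne_zero_of_liesOver P (pZ_ne_bot hp))⟩

/-- **The fundamental identity for `K = ℚ(∛2)`**: `∑_{P ∣ p} e_P f_P = 3`.
[cite: NeukirchANT1999, Ch. I Prop. 8.2] -/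
theorem sum_ramification_inertia_eq_three {p : ℕ} (hp : p.Prime) :
    ∑ P ∈ primesAbove p, Ideal.ramificationIdx' (pZ p) P * (pZ p).inertiaDeg' P = 3 := by
  classical
  haveI := pZ_isMaximal hp
  rw [primesAbove_eq_primesOverFinset hp, Ideal.sum_ramification_inertia (𝓞 K) ℚ K (pZ_ne_bot hp),
    finrank_K]

/-- `(p) = ∏_{P∣p} P^{e_P}` as the product of the normalized factors: the count of `P` in
`normalizedFactors (p)` is `e_P`, and its support is `primesAbove p`. [folklore] -/
theorem count_normalizedFactors_eq {p : ℕ} (hp : p.Prime) {P : Ideal (𝓞 K)} (hP : P ∈ primesAbove p) :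
    Multiset.count P (normalizedFactors (Ideal.span {((p : ℤ) : 𝓞 K)})) = Ideal.ramificationIdx' (pZ p) P := by
  classical
  obtain ⟨hP', hP0, -⟩ := (mem_primesAbove_iff hp).mp hP
  rw [← map_pZ, Ideal.IsDedekindDomain.ramificationIdx'_eq_normalizedFactors_count
    (by rw [map_pZ]; simp [hp.ne_zero]) hP' hP0]

/-- The support of `normalizedFactors (p)` is `primesAbove p`. [folklore] -/
theorem toFinset_normalizedFactors_eq {p : ℕ} (hp : p.Prime) :
    (normalizedFactors (Ideal.span {((p : ℤ) : 𝓞 K)})).toFinset = primesAbove p := by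
  classical
  rw [primesAbove_eq_primesOverFinset hp, IsDedekindDomain.primesOverFinset, map_pZ,
    UniqueFactorizationMonoid.factors_eq_normalizedFactors]

/-! ### Coordinates modulo `p` and the two excluded ramified configurations -/

/-- `x ∈ (p)` iff all coordinates of `x` in the basis `1, θ, θ²` are divisible by `p`. [folklore] -/
theorem coordElt_mem_span_iff (p : ℕ) (v : ℤ × ℤ × ℤ) :
    coordElt v ∈ Ideal.span {((p : ℤ) : 𝓞 K)} ↔ (p : ℤ) ∣ v.1 ∧ (p : ℤ) ∣ v.2.1 ∧ (p : ℤ) ∣ v.2.2 := by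
  rw [Ideal.mem_span_singleton]
  constructor
  · rintro ⟨y, hy⟩
    obtain ⟨w, rfl⟩ := coordElt_surjective y
    rw [← coordElt_smul] at hy
    have hv := coordElt_injective hy
    rw [hv]
    exact ⟨⟨w.1, by simp⟩, ⟨w.2.1, by simp⟩, ⟨w.2.2, by simp⟩⟩
  · rintro ⟨⟨a, ha⟩, ⟨b, hb⟩, ⟨c, hc⟩⟩
    refine ⟨coordElt (a, b, c), ?_⟩
    rw [← coordElt_smul]
    congr 1
    ext <;> simp [ha, hb, hc]

/-- `(θ − m)³ = (2 − m³) + 3m²θ − 3mθ²`. [folklore] -/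
theorem θint_sub_pow_three (m : ℤ) :
    (θint - (m : 𝓞 K)) ^ 3 = coordElt (2 - m ^ 3, 3 * m ^ 2, -3 * m) := by
  have h3 := θint_pow_three
  simp only [coordElt, Int.cast_sub, Int.cast_pow, Int.cast_mul, Int.cast_neg, Int.cast_ofNat]
  linear_combination h3

/-- `(θ − m₁)²(θ − m₂) = (2 − m₁²m₂) + (m₁² + 2m₁m₂)θ − (m₂ + 2m₁)θ²`. [folklore] -/
theorem θint_sub_sq_mul (m₁ m₂ : ℤ) :
    (θint - (m₁ : 𝓞 K)) ^ 2 * (θint - (m₂ : 𝓞 K)) =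
      coordElt (2 - m₁ ^ 2 * m₂, m₁ ^ 2 + 2 * m₁ * m₂, -(m₂ + 2 * m₁)) := by
  have h3 := θint_pow_three
  simp only [coordElt, Int.cast_sub, Int.cast_pow, Int.cast_mul, Int.cast_neg, Int.cast_add,
    Int.cast_ofNat]
  linear_combination h3

/-- For a prime `p ≥ 5`: `p ∤ 2` and `p ∤ 3·x ⇒`-type facts: `(p : ℤ) ∣ 3x → (p : ℤ) ∣ x`, and
`¬ (p : ℤ) ∣ 2`. [folklore] -/
theorem dvd_of_dvd_three_mul {p : ℕ} (hp : p.Prime) (h5 : 5 ≤ p) {x : ℤ} (h : (p : ℤ) ∣ 3 * x) :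
    (p : ℤ) ∣ x := by
  have hp' : Prime (p : ℤ) := Nat.prime_iff_prime_int.mp hp
  rcases hp'.dvd_or_dvd h with h3 | hx
  · exfalso
    have : (p : ℤ) ≤ 3 := Int.le_of_dvd (by norm_num) h3
    have : (p : ℤ) ≥ 5 := by exact_mod_cast h5
    omega
  · exact hx

/-- `¬ p ∣ 2` for `p ≥ 5`. [folklore] -/
theorem not_dvd_two {p : ℕ} (h5 : 5 ≤ p) : ¬ (p : ℤ) ∣ 2 := by
  intro h
  have : (p : ℤ) ≤ 2 := Int.le_of_dvd (by norm_num) h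
  have : (p : ℤ) ≥ 5 := by exact_mod_cast h5
  omega

/-- A prime of norm `p` has a root: `θ − m ∈ P` for some `m ∈ ℤ`. [folklore] -/
theorem exists_root {p : ℕ} (hp : p.Prime) {P : Ideal (𝓞 K)} (hN : Ideal.absNorm P = p) :
    ∃ m : ℤ, θint - (m : 𝓞 K) ∈ P :=
  exists_int_θint_sub_mem_of_prime_absNorm (hN ▸ hp)

/-- `(p)` is the product of its normalized factors. [folklore] -/
theorem prod_normalizedFactors_span {p : ℕ} (hp : p.Prime) :
    (normalizedFactors (Ideal.span {((p : ℤ) : 𝓞 K)})).prod = Ideal.span {((p : ℤ) : 𝓞 K)} := by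
  have h0 : Ideal.span {((p : ℤ) : 𝓞 K)} ≠ ⊥ := by simp [hp.ne_zero]
  exact associated_iff_eq.mp (prod_normalizedFactors h0)

/-- **No `p ≥ 5` is totally ramified**: `primesAbove p = {P}` with `N(P) = p` and `e_P = 3` is
impossible. [cite: NeukirchANT1999, Ch. I Prop. 8.3 (Dedekind–Kummer: p ∤ disc ⇒ unramified)] -/
theorem not_totally_ramified {p : ℕ} (hp : p.Prime) (h5 : 5 ≤ p) {P : Ideal (𝓞 K)}
    (hT : primesAbove p = {P}) (hN : Ideal.absNorm P = p) (he : Ideal.ramificationIdx' (pZ p) P = 3) :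
    False := by
  classical
  have hPmem : P ∈ primesAbove p := by rw [hT]; exact mem_singleton_self P
  -- `normalizedFactors (p) = {P, P, P}`, so `(p) = P³`
  set M := normalizedFactors (Ideal.span {((p : ℤ) : 𝓞 K)}) with hM
  have hsupp : M.toFinset = {P} := by rw [hM, toFinset_normalizedFactors_eq hp, hT]
  have hall : ∀ Q ∈ M, Q = P := fun Q hQ => by
    have : Q ∈ M.toFinset := Multiset.mem_toFinset.mpr hQ
    rw [hsupp] at this
    exact mem_singleton.mp this
  have hcount : M.count P = 3 := by rw [hM, count_normalizedFactors_eq hp hPmem, he]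
  have hcard : Multiset.card M = 3 := by
    rw [← hcount]; exact (Multiset.count_eq_card.mpr fun Q hQ => (hall Q hQ).symm).symm
  have hMeq : M = Multiset.replicate 3 P := Multiset.eq_replicate.mpr ⟨hcard, hall⟩
  have hspan : Ideal.span {((p : ℤ) : 𝓞 K)} = P ^ 3 := by
    rw [← prod_normalizedFactors_span hp, ← hM, hMeq, Multiset.prod_replicate]
  -- the root and the cube
  obtain ⟨m, hm⟩ := exists_root hp hN
  have hmem : (θint - (m : 𝓞 K)) ^ 3 ∈ Ideal.span {((p : ℤ) : 𝓞 K)} := by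
    rw [hspan]; exact Ideal.pow_mem_pow hm 3
  rw [θint_sub_pow_three, coordElt_mem_span_iff] at hmem
  obtain ⟨h1, h2, h3⟩ := hmem
  have hm3 : (p : ℤ) ∣ m := by
    have : (p : ℤ) ∣ 3 * m := by
      have := (dvd_neg.mpr h3); rwa [show -(-3 * m) = 3 * m by ring] at this
    exact dvd_of_dvd_three_mul hp h5 this
  have hm33 : (p : ℤ) ∣ m ^ 3 := dvd_pow hm3 (by norm_num)
  have : (p : ℤ) ∣ 2 := by
    have := dvd_add h1 hm33
    rwa [show 2 - m ^ 3 + m ^ 3 = (2 : ℤ) by ring] at this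
  exact not_dvd_two h5 this

/-- **No `p ≥ 5` is partially ramified**: `primesAbove p = {P₁, P₂}` (`P₁ ≠ P₂`) with
`N(P₁) = N(P₂) = p`, `e_{P₁} = 2`, `e_{P₂} = 1` is impossible.
[cite: NeukirchANT1999, Ch. I Prop. 8.3 (Dedekind–Kummer: p ∤ disc ⇒ unramified)] -/
theorem not_partially_ramified {p : ℕ} (hp : p.Prime) (h5 : 5 ≤ p) {P₁ P₂ : Ideal (𝓞 K)}
    (hne : P₁ ≠ P₂) (hT : primesAbove p = {P₁, P₂}) (hN₁ : Ideal.absNorm P₁ = p)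
    (hN₂ : Ideal.absNorm P₂ = p) (he₁ : Ideal.ramificationIdx' (pZ p) P₁ = 2)
    (he₂ : Ideal.ramificationIdx' (pZ p) P₂ = 1) : False := by
  classical
  have hP₁mem : P₁ ∈ primesAbove p := by rw [hT]; exact mem_insert_self _ _
  have hP₂mem : P₂ ∈ primesAbove p := by rw [hT]; exact mem_insert_of_mem (mem_singleton_self _)
  set M := normalizedFactors (Ideal.span {((p : ℤ) : 𝓞 K)}) with hM
  have hsupp : M.toFinset = {P₁, P₂} := by rw [hM, toFinset_normalizedFactors_eq hp, hT]
  have hc₁ : M.count P₁ = 2 := by rw [hM, count_normalizedFactors_eq hp hP₁mem, he₁]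
  have hc₂ : M.count P₂ = 1 := by rw [hM, count_normalizedFactors_eq hp hP₂mem, he₂]
  have hMeq : M = P₁ ::ₘ P₁ ::ₘ {P₂} := by
    ext Q
    by_cases hQ₁ : Q = P₁
    · subst hQ₁
      rw [hc₁]
      simp [hne]
    · by_cases hQ₂ : Q = P₂
      · subst hQ₂
        rw [hc₂]
        simp [hne.symm]
      · have hnot : Q ∉ M := fun h => by
          have : Q ∈ M.toFinset := Multiset.mem_toFinset.mpr h
          rw [hsupp, mem_insert, mem_singleton] at this
          exact this.elim hQ₁ hQ₂
        rw [Multiset.count_eq_zero_of_notMem hnot]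
        simp [hQ₁, hQ₂]
  have hspan : Ideal.span {((p : ℤ) : 𝓞 K)} = P₁ ^ 2 * P₂ := by
    rw [← prod_normalizedFactors_span hp, ← hM, hMeq]
    simp [Multiset.prod_cons, pow_two, mul_assoc]
  obtain ⟨m₁, hm₁⟩ := exists_root hp hN₁
  obtain ⟨m₂, hm₂⟩ := exists_root hp hN₂
  have hmem : (θint - (m₁ : 𝓞 K)) ^ 2 * (θint - (m₂ : 𝓞 K)) ∈ Ideal.span {((p : ℤ) : 𝓞 K)} := by
    rw [hspan]; exact Ideal.mul_mem_mul (Ideal.pow_mem_pow hm₁ 2) hm₂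
  rw [θint_sub_sq_mul, coordElt_mem_span_iff] at hmem
  obtain ⟨h1, h2, h3⟩ := hmem
  -- `p ∣ m₂ + 2m₁`, `p ∣ m₁² + 2m₁m₂`, `p ∣ 2 − m₁²m₂`
  have hA : (p : ℤ) ∣ m₂ + 2 * m₁ := by
    have := dvd_neg.mpr h3; rwa [neg_neg] at this
  have hB : (p : ℤ) ∣ 3 * m₁ ^ 2 := by
    -- `3m₁² = 2m₁(m₂ + 2m₁) − (m₁² + 2m₁m₂)`
    have := dvd_sub (dvd_mul_of_dvd_right hA (2 * m₁)) h2
    rwa [show 2 * m₁ * (m₂ + 2 * m₁) - (m₁ ^ 2 + 2 * m₁ * m₂) = 3 * m₁ ^ 2 by ring] at this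
  have hm₁ : (p : ℤ) ∣ m₁ := by
    have h := dvd_of_dvd_three_mul hp h5 hB
    exact (Nat.prime_iff_prime_int.mp hp).dvd_of_dvd_pow h
  have hm₂' : (p : ℤ) ∣ m₂ := by
    have := dvd_sub hA (dvd_mul_of_dvd_right hm₁ 2)
    rwa [show m₂ + 2 * m₁ - 2 * m₁ = m₂ by ring] at this
  have : (p : ℤ) ∣ 2 := by
    have h' : (p : ℤ) ∣ m₁ ^ 2 * m₂ := dvd_mul_of_dvd_right hm₂' _
    have := dvd_add h1 h'
    rwa [show 2 - m₁ ^ 2 * m₂ + m₁ ^ 2 * m₂ = (2 : ℤ) by ring] at this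
  exact not_dvd_two h5 this

/-! ### The classification for `p ≥ 5` -/

/-- Two primes `P₁ ≠ P₂` above `p ≥ 5` with `e₁f₁ = 1`, `e₂f₂ = 2` have `N(P₁) = p`, `N(P₂) = p²`
(the alternative `e₂ = 2, f₂ = 1` is excluded by `not_partially_ramified`). [folklore] -/
theorem norms_of_pair {p : ℕ} (hp : p.Prime) (h5 : 5 ≤ p) {P₁ P₂ : Ideal (𝓞 K)} (hne : P₁ ≠ P₂)
    (hT : primesAbove p = {P₁, P₂})
    (h1 : Ideal.ramificationIdx' (pZ p) P₁ * (pZ p).inertiaDeg' P₁ = 1)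
    (h2 : Ideal.ramificationIdx' (pZ p) P₂ * (pZ p).inertiaDeg' P₂ = 2) :
    Ideal.absNorm P₁ = p ∧ Ideal.absNorm P₂ = p ^ 2 := by
  have hP₁mem : P₁ ∈ primesAbove p := by rw [hT]; exact mem_insert_self _ _
  have hP₂mem : P₂ ∈ primesAbove p := by rw [hT]; exact mem_insert_of_mem (mem_singleton_self _)
  obtain ⟨hN₁, hf₁, he₁⟩ := absNorm_eq_pow_of_mem hp hP₁mem
  obtain ⟨hN₂, hf₂, he₂⟩ := absNorm_eq_pow_of_mem hp hP₂mem
  have he₁1 := Nat.eq_one_of_mul_eq_one_right h1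
  have hf₁1 := Nat.eq_one_of_mul_eq_one_left h1
  rw [hf₁1, pow_one] at hN₁
  refine ⟨hN₁, ?_⟩
  -- `f₂ ∣ 2`
  have hf₂dvd : (pZ p).inertiaDeg' P₂ ∣ 2 := Dvd.intro_left _ h2
  rcases (Nat.dvd_prime Nat.prime_two).mp hf₂dvd with hf₂1 | hf₂2
  · exfalso
    rw [hf₂1, mul_one] at h2
    rw [hf₂1, pow_one] at hN₂
    have hT' : primesAbove p = {P₂, P₁} := by rw [hT, pair_comm]
    exact not_partially_ramified hp h5 hne.symm hT' hN₂ hN₁ h2 he₁1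
  · rw [hf₂2] at hN₂
    exact hN₂

/-- **The splitting types of `p ≥ 5` in `ℚ(∛2)`**: `p` is inert (`N(P) = p³`), or `p = P₁P₂` with
`N(P₁) = p`, `N(P₂) = p²`, or `p = P₁P₂P₃` splits completely.
[cite: NeukirchANT1999, Ch. I Prop. 8.2–8.3] -/
theorem splitting_type {p : ℕ} (hp : p.Prime) (h5 : 5 ≤ p) :
    (∃ P, primesAbove p = {P} ∧ Ideal.absNorm P = p ^ 3) ∨
    (∃ P₁ P₂, P₁ ≠ P₂ ∧ primesAbove p = {P₁, P₂} ∧ Ideal.absNorm P₁ = p ∧ Ideal.absNorm P₂ = p ^ 2) ∨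
    (∃ P₁ P₂ P₃, P₁ ≠ P₂ ∧ P₁ ≠ P₃ ∧ P₂ ≠ P₃ ∧ primesAbove p = {P₁, P₂, P₃} ∧
      Ideal.absNorm P₁ = p ∧ Ideal.absNorm P₂ = p ∧ Ideal.absNorm P₃ = p) := by
  classical
  set T := primesAbove p with hTdef
  have hsum := sum_ramification_inertia_eq_three hp
  have hcard : #T ≤ 3 := card_primesAbove_le hp
  have hne : T.Nonempty := by
    by_contra h
    rw [Finset.not_nonempty_iff_eq_empty] at h
    rw [← hTdef, h, sum_empty] at hsum
    exact absurd hsum (by norm_num)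
  have hpos : 0 < #T := card_pos.mpr hne
  -- the three cardinalities
  rcases Nat.lt_or_ge #T 2 with hlt | hge
  · -- `#T = 1`
    obtain ⟨P, hT⟩ := card_eq_one.mp (show #T = 1 by omega)
    have hPmem : P ∈ T := by rw [hT]; exact mem_singleton_self P
    obtain ⟨hN, hf, he⟩ := absNorm_eq_pow_of_mem hp hPmem
    rw [← hTdef, hT, sum_singleton] at hsum
    have hfdvd : (pZ p).inertiaDeg' P ∣ 3 := Dvd.intro_left _ hsum
    rcases (Nat.dvd_prime Nat.prime_three).mp hfdvd with hf1 | hf3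
    · exfalso
      rw [hf1, mul_one] at hsum
      rw [hf1, pow_one] at hN
      exact not_totally_ramified hp h5 hT hN hsum
    · left
      rw [hf3] at hN
      exact ⟨P, hT, hN⟩
  · rcases Nat.lt_or_ge #T 3 with hlt3 | hge3
    · -- `#T = 2`
      obtain ⟨P₁, P₂, hne12, hT⟩ := card_eq_two.mp (show #T = 2 by omega)
      rw [← hTdef, hT, sum_pair hne12] at hsum
      have hP₁mem : P₁ ∈ T := by rw [hT]; exact mem_insert_self _ _
      have hP₂mem : P₂ ∈ T := by rw [hT]; exact mem_insert_of_mem (mem_singleton_self _)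
      obtain ⟨-, hf₁, he₁⟩ := absNorm_eq_pow_of_mem hp hP₁mem
      obtain ⟨-, hf₂, he₂⟩ := absNorm_eq_pow_of_mem hp hP₂mem
      have ha : 1 ≤ Ideal.ramificationIdx' (pZ p) P₁ * (pZ p).inertiaDeg' P₁ := Nat.one_le_iff_ne_zero.mpr
        (Nat.mul_ne_zero (by omega) (by omega))
      have hb : 1 ≤ Ideal.ramificationIdx' (pZ p) P₂ * (pZ p).inertiaDeg' P₂ := Nat.one_le_iff_ne_zero.mpr
        (Nat.mul_ne_zero (by omega) (by omega))
      right; left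
      rcases Nat.lt_or_ge (Ideal.ramificationIdx' (pZ p) P₁ * (pZ p).inertiaDeg' P₁) 2 with h1 | h1
      · have ha1 : Ideal.ramificationIdx' (pZ p) P₁ * (pZ p).inertiaDeg' P₁ = 1 := by omega
        have hb2 : Ideal.ramificationIdx' (pZ p) P₂ * (pZ p).inertiaDeg' P₂ = 2 := by omega
        obtain ⟨hN₁, hN₂⟩ := norms_of_pair hp h5 hne12 hT ha1 hb2
        exact ⟨P₁, P₂, hne12, hT, hN₁, hN₂⟩
      · have ha2 : Ideal.ramificationIdx' (pZ p) P₁ * (pZ p).inertiaDeg' P₁ = 2 := by omega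
        have hb1 : Ideal.ramificationIdx' (pZ p) P₂ * (pZ p).inertiaDeg' P₂ = 1 := by omega
        have hT' : primesAbove p = {P₂, P₁} := by rw [← hTdef, hT, pair_comm]
        obtain ⟨hN₂, hN₁⟩ := norms_of_pair hp h5 hne12.symm hT' hb1 ha2
        exact ⟨P₂, P₁, hne12.symm, hT', hN₂, hN₁⟩
    · -- `#T = 3`
      obtain ⟨P₁, P₂, P₃, h12, h13, h23, hT⟩ := card_eq_three.mp (show #T = 3 by omega)
      rw [← hTdef, hT, sum_insert (by simp [h12, h13]), sum_pair h23] at hsum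
      have hP₁mem : P₁ ∈ T := by rw [hT]; simp
      have hP₂mem : P₂ ∈ T := by rw [hT]; simp
      have hP₃mem : P₃ ∈ T := by rw [hT]; simp
      obtain ⟨hN₁, hf₁, he₁⟩ := absNorm_eq_pow_of_mem hp hP₁mem
      obtain ⟨hN₂, hf₂, he₂⟩ := absNorm_eq_pow_of_mem hp hP₂mem
      obtain ⟨hN₃, hf₃, he₃⟩ := absNorm_eq_pow_of_mem hp hP₃mem
      have h1 : 1 ≤ Ideal.ramificationIdx' (pZ p) P₁ * (pZ p).inertiaDeg' P₁ := Nat.one_le_iff_ne_zero.mpr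
        (Nat.mul_ne_zero (by omega) (by omega))
      have h2 : 1 ≤ Ideal.ramificationIdx' (pZ p) P₂ * (pZ p).inertiaDeg' P₂ := Nat.one_le_iff_ne_zero.mpr
        (Nat.mul_ne_zero (by omega) (by omega))
      have h3 : 1 ≤ Ideal.ramificationIdx' (pZ p) P₃ * (pZ p).inertiaDeg' P₃ := Nat.one_le_iff_ne_zero.mpr
        (Nat.mul_ne_zero (by omega) (by omega))
      have e1 : Ideal.ramificationIdx' (pZ p) P₁ * (pZ p).inertiaDeg' P₁ = 1 := by omega
      have e2 : Ideal.ramificationIdx' (pZ p) P₂ * (pZ p).inertiaDeg' P₂ = 1 := by omega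
      have e3 : Ideal.ramificationIdx' (pZ p) P₃ * (pZ p).inertiaDeg' P₃ = 1 := by omega
      rw [Nat.eq_one_of_mul_eq_one_left e1, pow_one] at hN₁
      rw [Nat.eq_one_of_mul_eq_one_left e2, pow_one] at hN₂
      rw [Nat.eq_one_of_mul_eq_one_left e3, pow_one] at hN₃
      right; right
      exact ⟨P₁, P₂, P₃, h12, h13, h23, hT, hN₁, hN₂, hN₃⟩

/-- `g(p)` is the number of primes of norm `p` above `p`, as a natural number. [folklore] -/
theorem cubeRootTwoCount_eq_card {p : ℕ} (hp : p.Prime) :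
    cubeRootTwoCount p = #((primesAbove p).filter fun P => Ideal.absNorm P = p) := by
  classical
  have h := card_primesAbove_filter_absNorm_eq (p := p) hp
  exact_mod_cast h.symm

/-- **`g(p) ∈ {0, 1, 3}` for primes `p ≥ 5`**, with the splitting type determined by `g(p)`.
[cite: HeathBrown2001LargestPrimeFactorCubic, p. 12 ("according as g(p) = 0, 1, 3")] -/
theorem cubeRootTwoCount_mem {p : ℕ} (hp : p.Prime) (h5 : 5 ≤ p) :
    cubeRootTwoCount p = 0 ∨ cubeRootTwoCount p = 1 ∨ cubeRootTwoCount p = 3 := by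
  classical
  have hp2 : p ^ 2 ≠ p := by
    intro h; have := hp.two_le; nlinarith
  have hp3 : p ^ 3 ≠ p := by
    intro h; have := hp.two_le; nlinarith [pow_pos hp.pos 2]
  rw [cubeRootTwoCount_eq_card hp]
  rcases splitting_type hp h5 with ⟨P, hT, hN⟩ | ⟨P₁, P₂, hne, hT, hN₁, hN₂⟩ |
    ⟨P₁, P₂, P₃, h12, h13, h23, hT, hN₁, hN₂, hN₃⟩
  · left
    rw [hT, Finset.card_eq_zero, Finset.filter_eq_empty_iff]
    intro Q hQ
    rw [mem_singleton] at hQ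
    rw [hQ, hN]; exact hp3
  · right; left
    rw [hT, Finset.filter_insert, if_pos hN₁, Finset.filter_singleton, if_neg (by rw [hN₂]; exact hp2),
      Finset.insert_empty, card_singleton]
  · right; right
    rw [hT, Finset.filter_insert, if_pos hN₁, Finset.filter_insert, if_pos hN₂, Finset.filter_singleton,
      if_pos hN₃]
    rw [card_insert_of_notMem (by simp [h12, h13]), card_pair h23]

/-! ### The local factors `∏_{P∣p}(1 − N(P)⁻¹)` -/

/-- `1 − normDensityAt p = ∏_{P∣p}(1 − N(P)⁻¹)`. [folklore] -/
theorem one_sub_normDensityAt (p : ℕ) :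
    1 - normDensityAt p = ∏ P ∈ primesAbove p, (1 - ((Ideal.absNorm P : ℕ) : ℝ)⁻¹) := by
  rw [normDensityAt]; ring

/-- **The local factor of `ζ_K` at `p ≥ 5` by `g(p)`**: `∏_{P∣p}(1 − N(P)⁻¹) = 1 − p⁻³` (`g = 0`),
`(1 − p⁻¹)(1 − p⁻²)` (`g = 1`), `(1 − p⁻¹)³` (`g = 3`).
[cite: HeathBrown2001LargestPrimeFactorCubic, p. 12 (k(p)) and Lemma 9] -/
theorem one_sub_normDensityAt_eq {p : ℕ} (hp : p.Prime) (h5 : 5 ≤ p) :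
    1 - normDensityAt p =
      if cubeRootTwoCount p = 0 then 1 - ((p : ℝ) ^ 3)⁻¹
      else if cubeRootTwoCount p = 1 then (1 - (p : ℝ)⁻¹) * (1 - ((p : ℝ) ^ 2)⁻¹)
      else (1 - (p : ℝ)⁻¹) ^ 3 := by
  classical
  have hp2 : p ^ 2 ≠ p := by
    intro h; have := hp.two_le; nlinarith
  have hp3 : p ^ 3 ≠ p := by
    intro h; have := hp.two_le; nlinarith [pow_pos hp.pos 2]
  have hg := cubeRootTwoCount_eq_card hp
  rw [one_sub_normDensityAt]
  rcases splitting_type hp h5 with ⟨P, hT, hN⟩ | ⟨P₁, P₂, hne, hT, hN₁, hN₂⟩ |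
    ⟨P₁, P₂, P₃, h12, h13, h23, hT, hN₁, hN₂, hN₃⟩
  · have hg0 : cubeRootTwoCount p = 0 := by
      rw [hg, hT, Finset.card_eq_zero, Finset.filter_eq_empty_iff]
      intro Q hQ; rw [mem_singleton] at hQ; rw [hQ, hN]; exact hp3
    rw [if_pos hg0, hT, prod_singleton, hN]
    push_cast; ring
  · have hg1 : cubeRootTwoCount p = 1 := by
      rw [hg, hT, Finset.filter_insert, if_pos hN₁, Finset.filter_singleton,
        if_neg (by rw [hN₂]; exact hp2), Finset.insert_empty, card_singleton]
    rw [if_neg (by rw [hg1]; norm_num), if_pos hg1, hT, prod_pair hne, hN₁, hN₂]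
    push_cast; ring
  · have hg3 : cubeRootTwoCount p = 3 := by
      rw [hg, hT, Finset.filter_insert, if_pos hN₁, Finset.filter_insert, if_pos hN₂,
        Finset.filter_singleton, if_pos hN₃, card_insert_of_notMem (by simp [h12, h13]), card_pair h23]
    rw [if_neg (by rw [hg3]; norm_num), if_neg (by rw [hg3]; norm_num), hT,
      prod_insert (by simp [h12, h13]), prod_pair h23, hN₁, hN₂, hN₃]
    ring

/-! ### The ramified primes `2 = P₂³` and `3 = P₃³` -/

/-- If `(p) = P₀³` for a prime ideal `P₀`, then `primesAbove p = {P₀}`. [folklore] -/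
theorem primesAbove_eq_singleton_of_cube {p : ℕ} (hp : p.Prime) {P₀ : Ideal (𝓞 K)} (hP₀ : P₀.IsPrime)
    (hP₀0 : P₀ ≠ ⊥) (hcube : Ideal.span {((p : ℤ) : 𝓞 K)} = P₀ ^ 3) : primesAbove p = {P₀} := by
  classical
  haveI := pZ_isMaximal hp
  have hP₀max : P₀.IsMaximal := hP₀.isMaximal hP₀0
  ext P
  rw [mem_singleton]
  constructor
  · intro hP
    obtain ⟨hPp, hover⟩ := liesOver_of_mem_primesAbove hp hP
    have hpP : ((p : ℤ) : 𝓞 K) ∈ P := by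
      have h1 : (p : ℤ) ∈ P.under ℤ := by
        rw [← hover.over]; exact Ideal.mem_span_singleton_self _
      rw [Ideal.under_def, Ideal.mem_comap] at h1
      simpa using h1
    have hle : P₀ ^ 3 ≤ P := by
      rw [← hcube, Ideal.span_singleton_le_iff_mem]; exact hpP
    have hle' : P₀ ≤ P := hPp.le_of_pow_le hle
    exact (hP₀max.eq_of_le hPp.ne_top hle').symm
  · intro hP
    subst hP
    rw [mem_primesAbove_iff hp]
    refine ⟨hP₀, hP₀0, ?_⟩
    have hNp : Ideal.absNorm (Ideal.span {((p : ℤ) : 𝓞 K)}) = p ^ 3 := by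
      have := Literature.NumberTheory.LFunctions.IdealNormCount.absNorm_span_natCast K p
      rw [finrank_K] at this
      simpa using this
    have h3 : Ideal.absNorm P ^ 3 = p ^ 3 := by rw [← map_pow, ← hcube, hNp]
    have hNP : Ideal.absNorm P = p := Nat.pow_left_injective (by norm_num) h3
    rw [hNP]

/-- `N((θ)) = 2` and `N((θ + 1)) = 3`. [folklore] -/
theorem absNorm_span_θint : Ideal.absNorm (Ideal.span {(θint : 𝓞 K)}) = 2 ∧
    Ideal.absNorm (Ideal.span {(θint + 1 : 𝓞 K)}) = 3 := by
  have h1 : (θint : 𝓞 K) = coordElt (0, 1, 0) := by simp [coordElt]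
  have h2 : (θint + 1 : 𝓞 K) = coordElt (1, 1, 0) := by simp [coordElt]; ring
  constructor
  · rw [Ideal.absNorm_span_singleton, h1, norm_coordElt]; norm_num
  · rw [Ideal.absNorm_span_singleton, h2, norm_coordElt]; norm_num

/-- `(θ)` and `(θ + 1)` are nonzero prime ideals. [folklore] -/
theorem span_θint_isPrime :
    (Ideal.span {(θint : 𝓞 K)}).IsPrime ∧ Ideal.span {(θint : 𝓞 K)} ≠ ⊥ ∧
      (Ideal.span {(θint + 1 : 𝓞 K)}).IsPrime ∧ Ideal.span {(θint + 1 : 𝓞 K)} ≠ ⊥ := by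
  obtain ⟨h2, h3⟩ := absNorm_span_θint
  refine ⟨Ideal.isPrime_of_irreducible_absNorm (by rw [h2]; exact Nat.prime_two.prime.irreducible),
    fun h => by rw [h, Ideal.absNorm_bot] at h2; exact absurd h2 (by norm_num),
    Ideal.isPrime_of_irreducible_absNorm (by rw [h3]; exact Nat.prime_three.prime.irreducible),
    fun h => by rw [h, Ideal.absNorm_bot] at h3; exact absurd h3 (by norm_num)⟩

/-- **`2 = (θ)³`** (`θ³ = 2`). [folklore] -/
theorem span_two_eq_cube : Ideal.span {(((2 : ℕ) : ℤ) : 𝓞 K)} = Ideal.span {(θint : 𝓞 K)} ^ 3 := by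
  rw [Ideal.span_singleton_pow, θint_pow_three]
  norm_num

/-- **`3 = (θ + 1)³`** as ideals (`(θ + 1)³ = 3(1 + θ + θ²)`, `1 + θ + θ² = ε₀` a unit). [folklore] -/
theorem span_three_eq_cube : Ideal.span {(((3 : ℕ) : ℤ) : 𝓞 K)} = Ideal.span {(θint + 1 : 𝓞 K)} ^ 3 := by
  rw [Ideal.span_singleton_pow]
  have hcube : (θint + 1 : 𝓞 K) ^ 3 = (3 : 𝓞 K) * (epsUnit : 𝓞 K) := by
    rw [coe_epsUnit]
    have h3 := θint_pow_three
    simp only [coordElt, Int.cast_one]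
    linear_combination h3
  rw [hcube, Ideal.span_singleton_mul_right_unit epsUnit.isUnit]
  norm_num

/-- `primesAbove 2 = {(θ)}` and `primesAbove 3 = {(θ + 1)}`. [folklore] -/
theorem primesAbove_two_three : primesAbove 2 = {Ideal.span {(θint : 𝓞 K)}} ∧
    primesAbove 3 = {Ideal.span {(θint + 1 : 𝓞 K)}} := by
  obtain ⟨hp2, h20, hp3, h30⟩ := span_θint_isPrime
  exact ⟨primesAbove_eq_singleton_of_cube Nat.prime_two hp2 h20 span_two_eq_cube,
    primesAbove_eq_singleton_of_cube Nat.prime_three hp3 h30 span_three_eq_cube⟩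

/-- **The local factors at the ramified primes**: `∏_{P∣2}(1 − N(P)⁻¹) = 1/2`,
`∏_{P∣3}(1 − N(P)⁻¹) = 2/3`. [cite: HeathBrown2001LargestPrimeFactorCubic, Lemma 9 (C₃)] -/
theorem one_sub_normDensityAt_two_three : 1 - normDensityAt 2 = 1 / 2 ∧ 1 - normDensityAt 3 = 2 / 3 := by
  obtain ⟨hT2, hT3⟩ := primesAbove_two_three
  obtain ⟨hN2, hN3⟩ := absNorm_span_θint
  constructor
  · rw [one_sub_normDensityAt, hT2, prod_singleton, hN2]; norm_num
  · rw [one_sub_normDensityAt, hT3, prod_singleton, hN3]; norm_num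

end Literature.NumberTheory.Sieve.HeathBrown2001
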